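import Literature.NumberTheory.Transcendental.VarietyAscent
import Literature.NumberTheory.Transcendental.ExpVarietiesRotundProofs
import Literature.FieldTheory.Regular.RegularBaseChange
import Mathlib.RingTheory.Localization.Away.Basic
import HarnessLib

/-!
# Ascent of rotundity along an extension of algebraically closed fields

Companion of `VarietyAscent.lean`: for `E → F` an extension of algebraically closed fields
(`E` of characteristic zero) and an irreducible closed `W ⊆ E^{n ⊕ n}` meeting the torus, if
`W ∩ Gⁿ` is rotund (Zilber 2005 §3: `dim [M](W ∩ Gⁿ) ≥ rk M` for every integer matrix `M`)
then so is `W_F ∩ Gⁿ`, where `W_F` is the base change (`VarietyAscent.isRotund_baseChange`).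

Proof. The action `[M]` of an integer matrix involves Laurent monomials `∏ⱼ yⱼ^{Mᵢⱼ}`; to stay
with polynomials we pass to the graph of inversion: the prime ideal `P' ⊆ E[X, Y, Y']` of the
points `(x, y, y⁻¹)`, `(x, y) ∈ W ∩ Gⁿ` — the kernel of the map `E[X, Y, Y'] → (E[X, Y]/P)[1/∏Ȳ]`,
`Y'ᵢ ↦ Ȳᵢ⁻¹` (`graphIdeal`), so prime for free — on whose zero set `[M]` is given by polynomials
`θ_M` with integer coefficients (`theta`). The `E`-algebra map `φ_E = (mod P') ∘ θ_M^*` kills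
exactly… at least the polynomials vanishing on `[M](W ∩ Gⁿ)` is what we need in the converse
direction: `ker φ_E ⊆ I_E([M](W ∩ Gⁿ))`, so `rk M ≤ dim [M](W ∩ Gⁿ) ≤ dim E[X]/ker φ_E =
trdeg_E (range φ_E)`, and `rk M` of the `2n` generators `φ_E(Xᵢ)` are algebraically independent
over `E`. They stay algebraically independent over `F` in `F[X, Y, Y'] ⧸ P'F[X, Y, Y']`
(`Literature.FieldTheory.Regular.algebraicIndependent_map_mk`; this quotient is a domain since `E`
is algebraically closed, `VarietyAscent.isPrime_map`), where they are the images of the same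
generators under `φ_F`; and `φ_F` kills `I_F([M](W_F ∩ Gⁿ))` (the points of `Z_F(P'F[X,Y,Y'])`
are the `(z, z_y⁻¹)`, `z ∈ W_F ∩ Gⁿ`, and `I_F(Z_F(P'F)) = P'F` by the Nullstellensatz), so
`rk M ≤ dim [M](W_F ∩ Gⁿ)` by `le_zariskiDim_of_algebraicIndependent`.

## References

* B. Zilber, Ann. Pure Appl. Logic 132 (2005): §2–3 (`[M]`, rotund varieties).
* M. Bays, J. Kirby, Algebra & Number Theory 12 (2018): Def. 7.1, Thm 8.2 (proof).
* U. Görtz, T. Wedhorn, *Algebraic Geometry I*, Prop. 5.38.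
-/

noncomputable section

open MvPolynomial Set

universe u

namespace Literature.NumberTheory.Transcendental

namespace VarietyAscent

/-! ### The graph of inversion over a prime ideal meeting the torus -/

section Graph

variable {k : Type u} [Field k] {n : ℕ}

/-- The index type of `k[X, Y, Y']`: the `2n` coordinates of `Gⁿ` and `n` inverse coordinates.
[folklore] -/
abbrev GIdx (n : ℕ) : Type := (Fin n ⊕ Fin n) ⊕ Fin n

variable (P : Ideal (MvPolynomial (Fin n ⊕ Fin n) k))

/-- The product of the multiplicative coordinates, modulo `P`. [folklore] -/
def prodY : MvPolynomial (Fin n ⊕ Fin n) k ⧸ P := Ideal.Quotient.mk P (∏ i, X (Sum.inr i))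

/-- The localisation `(k[X, Y] ⧸ P)[1/∏Ȳ]`. [folklore] -/
abbrev Loc : Type u := Localization.Away (prodY P)

/-- `Ȳᵢ` is a unit of `(k[X, Y] ⧸ P)[1/∏Ȳ]`. [folklore] -/
theorem isUnit_algebraMap_Y (i : Fin n) :
    IsUnit (algebraMap (MvPolynomial (Fin n ⊕ Fin n) k ⧸ P) (Loc P) (Ideal.Quotient.mk P (X (Sum.inr i)))) := by
  refine isUnit_of_dvd_unit ?_ (IsLocalization.Away.algebraMap_isUnit (prodY P))
  exact map_dvd _ (map_dvd _ (Finset.dvd_prod_of_mem _ (Finset.mem_univ i)))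

/-- The point `(x̄, ȳ, ȳ⁻¹)` of `(k[X, Y] ⧸ P)[1/∏Ȳ]`. [folklore] -/
def graphPt : GIdx n → Loc P :=
  Sum.elim (fun j => algebraMap _ (Loc P) (Ideal.Quotient.mk P (X j)))
    (fun i => ((isUnit_algebraMap_Y P i).unit⁻¹ : (Loc P)ˣ))

/-- The `k`-algebra map `k[X, Y, Y'] → (k[X, Y] ⧸ P)[1/∏Ȳ]`, `Y'ᵢ ↦ Ȳᵢ⁻¹`. [folklore] -/
def graphMap : MvPolynomial (GIdx n) k →ₐ[k] Loc P := aeval (graphPt P)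

/-- **The ideal of the graph of inversion** over `P`: the kernel of `graphMap`. [folklore] -/
def graphIdeal : Ideal (MvPolynomial (GIdx n) k) := RingHom.ker (graphMap P)

/-- On polynomials in `X, Y` only, `graphMap` is reduction modulo `P`. [folklore] -/
theorem graphMap_rename_inl (p : MvPolynomial (Fin n ⊕ Fin n) k) :
    graphMap P (rename Sum.inl p) =
      algebraMap (MvPolynomial (Fin n ⊕ Fin n) k ⧸ P) (Loc P) (Ideal.Quotient.mk P p) := by
  have h : ((graphMap P).comp (rename Sum.inl : MvPolynomial (Fin n ⊕ Fin n) k →ₐ[k] _)) =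
      (IsScalarTower.toAlgHom k (MvPolynomial (Fin n ⊕ Fin n) k ⧸ P) (Loc P)).comp
        (Ideal.Quotient.mkₐ k P) := by
    refine MvPolynomial.algHom_ext fun j => ?_
    simp [graphMap, graphPt]
  exact congr_arg (fun g : MvPolynomial (Fin n ⊕ Fin n) k →ₐ[k] Loc P => g p) h

/-- `P ⊆ P'` along `X, Y ↦ X, Y`. [folklore] -/
theorem rename_inl_mem_graphIdeal {p : MvPolynomial (Fin n ⊕ Fin n) k} (hp : p ∈ P) :
    rename Sum.inl p ∈ graphIdeal P := by
  rw [graphIdeal, RingHom.mem_ker]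
  change graphMap P (rename Sum.inl p) = 0
  rw [graphMap_rename_inl, Ideal.Quotient.eq_zero_iff_mem.2 hp, map_zero]

/-- `Yᵢ Y'ᵢ - 1 ∈ P'`. [folklore] -/
theorem X_mul_X_sub_one_mem_graphIdeal (i : Fin n) :
    X (Sum.inl (Sum.inr i)) * X (Sum.inr i) - 1 ∈ graphIdeal P := by
  rw [graphIdeal, RingHom.mem_ker]
  change graphMap P _ = 0
  simp only [graphMap, map_sub, map_mul, aeval_X, map_one, graphPt, Sum.elim_inl, Sum.elim_inr]
  have : algebraMap (MvPolynomial (Fin n ⊕ Fin n) k ⧸ P) (Loc P) (Ideal.Quotient.mk P (X (Sum.inr i))) *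
      (((isUnit_algebraMap_Y P i).unit⁻¹ : (Loc P)ˣ) : Loc P) = 1 := by
    exact_mod_cast (isUnit_algebraMap_Y P i).mul_val_inv
  rw [this, sub_self]

variable [P.IsPrime] (hP : prodY P ≠ 0)
include hP

/-- The localisation is a domain. [folklore] -/
theorem isDomain_loc : IsDomain (Loc P) :=
  haveI : IsDomain (MvPolynomial (Fin n ⊕ Fin n) k ⧸ P) := Ideal.Quotient.isDomain P
  Localization.Away.isDomain hP

/-- **`P'` is prime.** [folklore] -/
theorem isPrime_graphIdeal : (graphIdeal P).IsPrime := by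
  haveI := isDomain_loc P hP
  exact RingHom.ker_isPrime _

omit [P.IsPrime] hP in
/-- **Evaluation at a torus point factors through the localisation**: if `z ∈ T^{n ⊕ n}` (in a
field `T` over `k`) kills `P` and has non-zero multiplicative coordinates, then some `k`-algebra
map `g : (k[X,Y]/P)[1/∏Ȳ] → T` satisfies `g (graphMap q) = q(z, z_y⁻¹)` for all `q`. [folklore] -/
theorem exists_factor {T : Type*} [Field T] [Algebra k T] (z : Fin n ⊕ Fin n → T)
    (hzP : ∀ p ∈ P, aeval z p = 0) (hzt : ∀ i, z (Sum.inr i) ≠ 0) :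
    ∃ g : Loc P →ₐ[k] T, ∀ q, g (graphMap P q) = aeval (Sum.elim z fun i => (z (Sum.inr i))⁻¹) q := by
  -- evaluation at `z` through the quotient
  let e₀ : (MvPolynomial (Fin n ⊕ Fin n) k ⧸ P) →ₐ[k] T :=
    Ideal.Quotient.liftₐ P (aeval z) fun p hp => hzP p hp
  have he₀ : ∀ p, e₀ (Ideal.Quotient.mk P p) = aeval z p := fun p => rfl
  have hunit : IsUnit (e₀ (prodY P)) := by
    rw [prodY, he₀, map_prod]
    simp only [aeval_X]
    exact isUnit_iff_ne_zero.2 (Finset.prod_ne_zero_iff.2 fun i _ => hzt i)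
  -- extend to the localisation
  let g₀ : Loc P →+* T := IsLocalization.Away.lift (prodY P) (g := e₀.toRingHom) hunit
  have hg₀ : ∀ r, g₀ (algebraMap _ (Loc P) r) = e₀ r := fun r =>
    IsLocalization.Away.lift_eq (prodY P) hunit r
  let g : Loc P →ₐ[k] T :=
    { g₀ with
      commutes' := fun c => by
        change g₀ (algebraMap k (Loc P) c) = algebraMap k T c
        rw [IsScalarTower.algebraMap_apply k (MvPolynomial (Fin n ⊕ Fin n) k ⧸ P) (Loc P), hg₀,
          AlgHom.commutes] }
  have hg : ∀ r, g (algebraMap _ (Loc P) r) = e₀ r := hg₀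
  refine ⟨g, fun q => ?_⟩
  -- both sides are `k`-algebra maps agreeing on the variables
  have key : (g.comp (graphMap P)) = aeval (Sum.elim z fun i => (z (Sum.inr i))⁻¹) := by
    refine MvPolynomial.algHom_ext fun c => ?_
    rcases c with j | i
    · simp only [AlgHom.comp_apply, graphMap, aeval_X, graphPt, Sum.elim_inl]
      rw [hg, he₀, aeval_X]
    · simp only [AlgHom.comp_apply, graphMap, aeval_X, graphPt, Sum.elim_inr]
      have hu : g ((isUnit_algebraMap_Y P i).unit : Loc P) = z (Sum.inr i) := by
        rw [IsUnit.unit_spec, hg, he₀, aeval_X]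
      have : g (((isUnit_algebraMap_Y P i).unit⁻¹ : (Loc P)ˣ) : Loc P) * z (Sum.inr i) = 1 := by
        rw [← hu, ← map_mul, Units.inv_mul, map_one]
      exact eq_inv_of_mul_eq_one_left this
  exact congr_arg (fun h : MvPolynomial (GIdx n) k →ₐ[k] T => h q) key

omit [P.IsPrime] hP in
/-- Hence polynomials of `P'` vanish at every point `(z, z_y⁻¹)` with `z` a torus point killing
`P`. [folklore] -/
theorem aeval_eq_zero_of_mem_graphIdeal {T : Type*} [Field T] [Algebra k T] (z : Fin n ⊕ Fin n → T)
    (hzP : ∀ p ∈ P, aeval z p = 0) (hzt : ∀ i, z (Sum.inr i) ≠ 0) {q : MvPolynomial (GIdx n) k}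
    (hq : q ∈ graphIdeal P) : aeval (Sum.elim z fun i => (z (Sum.inr i))⁻¹) q = 0 := by
  obtain ⟨g, hg⟩ := exists_factor P z hzP hzt
  rw [← hg q, show graphMap P q = 0 from hq, map_zero]

end Graph

/-! ### The action of an integer matrix as polynomials on the graph of inversion -/

section Theta

variable {k : Type u} [CommRing k] {n : ℕ}

/-- **`θ_M`**: polynomials in `X, Y, Y'` with integer coefficients computing `[M](x, y)` on the
graph `Y' = Y⁻¹`: `θ_M(inl i) = ∑ⱼ Mᵢⱼ Xⱼ`, `θ_M(inr i) = ∏ⱼ Yⱼ^{Mᵢⱼ⁺} Y'ⱼ^{Mᵢⱼ⁻}`.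
[cite: Zilber2005, §2 ([M] : G_n → G_n)] -/
def theta (M : Matrix (Fin n) (Fin n) ℤ) : Fin n ⊕ Fin n → MvPolynomial (GIdx n) k :=
  Sum.elim (fun i => ∑ j, C ((M i j : ℤ) : k) * X (Sum.inl (Sum.inl j)))
    (fun i => ∏ j, X (Sum.inl (Sum.inr j)) ^ (M i j).toNat * X (Sum.inr j) ^ (-(M i j)).toNat)

/-- `θ_M` has integer coefficients: it is unchanged by extension of scalars. [folklore] -/
theorem map_theta {k' : Type*} [CommRing k'] (f : k →+* k') (M : Matrix (Fin n) (Fin n) ℤ)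
    (c : Fin n ⊕ Fin n) : MvPolynomial.map f (theta M c) = theta M c := by
  rcases c with i | i
  · simp [theta, map_sum]
  · simp [theta, map_prod]

/-- **`θ_M` computes `[M]` on the graph of inversion**: for a point `w = (x, y, y')` with
`yⱼ y'ⱼ = 1`, `θ_M(w) = [M](x, y)` (in a field). [cite: Zilber2005, §2 ([M] : G_n → G_n)] -/
theorem aeval_theta {T : Type*} [Field T] [Algebra k T] (M : Matrix (Fin n) (Fin n) ℤ)
    (w : GIdx n → T) (hw : ∀ j, w (Sum.inl (Sum.inr j)) * w (Sum.inr j) = 1) :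
    (fun c => aeval w (theta (k := k) M c)) = matrixAct M (w ∘ Sum.inl) := by
  funext c
  rcases c with i | i
  · simp [theta, map_sum, matrixAct_inl]
  · simp only [theta, Sum.elim_inr, map_prod, map_mul, map_pow, aeval_X, matrixAct_inr,
      Function.comp_apply]
    refine Finset.prod_congr rfl fun j _ => ?_
    have hne : w (Sum.inl (Sum.inr j)) ≠ 0 := fun h => by simpa [h] using hw j
    have hinv : w (Sum.inr j) = (w (Sum.inl (Sum.inr j)))⁻¹ :=
      eq_inv_of_mul_eq_one_right (hw j)
    rw [hinv, inv_pow, ← zpow_natCast, ← zpow_natCast, ← zpow_neg, ← zpow_add₀ hne]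
    congr 1
    have := Int.toNat_sub_toNat_neg (M i j)
    omega

end Theta

/-! ### Rotundity ascends -/

section Ascent

variable {E F : Type u} [Field E] [CharZero E] [IsAlgClosed E] [Field F] [IsAlgClosed F] [Algebra E F]
  {n : ℕ} {W : Set (Fin n ⊕ Fin n → E)}

omit [CharZero E] [IsAlgClosed E] in
/-- `∏ Yᵢ ∉ I_E(W)` when `W` meets the torus. [folklore] -/
theorem prodY_ne_zero (hne : (W ∩ torusLocus E n).Nonempty) : prodY (vanishingIdeal E W) ≠ 0 := by
  obtain ⟨m, hmW, hmt⟩ := hne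
  intro h
  rw [prodY, Ideal.Quotient.eq_zero_iff_mem, mem_vanishingIdeal_iff] at h
  have := h m hmW
  rw [map_prod] at this
  simp only [aeval_X] at this
  exact Finset.prod_ne_zero_iff.2 (fun i _ => hmt i) this

omit [CharZero E] [IsAlgClosed E] [IsAlgClosed F] in
/-- The `F`-points of `Z_F(P'·F[X,Y,Y'])` are the `(z, z_y⁻¹)`, `z ∈ W_F ∩ Gⁿ`: first block in the
base change, and `Yⱼ Y'ⱼ = 1`. [folklore] -/
theorem mem_zeroLocus_graphIdeal_map {w : GIdx n → F}
    (hw : w ∈ zeroLocus F ((graphIdeal (vanishingIdeal E W)).map (MvPolynomial.map (algebraMap E F)))) :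
    (w ∘ Sum.inl) ∈ baseChange F W ∧ ∀ j, w (Sum.inl (Sum.inr j)) * w (Sum.inr j) = 1 := by
  rw [mem_zeroLocus_iff] at hw
  have hw' : ∀ q ∈ graphIdeal (vanishingIdeal E W), aeval w q = 0 := fun q hq => by
    have := hw _ (Ideal.mem_map_of_mem _ hq)
    rwa [aeval_map_algebraMap] at this
  refine ⟨?_, fun j => ?_⟩
  · rw [baseChange, mem_zeroLocus_iff]
    intro p hp
    have := hw' _ (rename_inl_mem_graphIdeal _ hp)
    rwa [aeval_rename] at this
  · have := hw' _ (X_mul_X_sub_one_mem_graphIdeal (vanishingIdeal E W) j)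
    simp only [map_sub, map_mul, aeval_X, map_one] at this
    exact sub_eq_zero.1 this

/-- Composition of `aeval` with `θ_M`: evaluating `θ_M^*(p)` at `w` is evaluating `p` at
`θ_M(w)`. [folklore] -/
theorem aeval_aeval_theta {k : Type u} [Field k] {T : Type*} [Field T] [Algebra k T]
    (M : Matrix (Fin n) (Fin n) ℤ) (w : GIdx n → T) (p : MvPolynomial (Fin n ⊕ Fin n) k) :
    aeval w (aeval (theta (k := k) M) p) = aeval (fun c => aeval w (theta (k := k) M c)) p := by
  rw [← AlgHom.comp_apply, comp_aeval]

/-- **`φ_F` kills the polynomials vanishing on `[M](W_F ∩ Gⁿ)`.** [folklore] -/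
theorem vanishingIdeal_image_le_ker (hirr : IsIrreducibleClosed E W) (hne : (W ∩ torusLocus E n).Nonempty)
    (M : Matrix (Fin n) (Fin n) ℤ) :
    vanishingIdeal F (matrixAct M '' (baseChange F W ∩ torusLocus F n)) ≤
      RingHom.ker ((Ideal.Quotient.mkₐ F ((graphIdeal (vanishingIdeal E W)).map
        (MvPolynomial.map (algebraMap E F)))).comp (aeval (theta (k := F) M))) := by
  haveI := hirr.2
  have hP := prodY_ne_zero hne
  set P'F := (graphIdeal (vanishingIdeal E W)).map (MvPolynomial.map (algebraMap E F)) with hP'F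
  haveI hprime : P'F.IsPrime := by
    haveI := isPrime_graphIdeal _ hP
    exact isPrime_map (F := F) _
  intro p hp
  rw [RingHom.mem_ker, AlgHom.comp_apply, Ideal.Quotient.mkₐ_eq_mk, Ideal.Quotient.eq_zero_iff_mem]
  -- by the Nullstellensatz it suffices to vanish on `Z_F(P'F)`
  rw [← hprime.radical, ← vanishingIdeal_zeroLocus_eq_radical (K := F), mem_vanishingIdeal_iff]
  intro w hw
  obtain ⟨hwW, hwinv⟩ := mem_zeroLocus_graphIdeal_map hw
  have hwt : (w ∘ Sum.inl) ∈ torusLocus F n := fun j h => by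
    have := hwinv j
    rw [show w (Sum.inl (Sum.inr j)) = 0 from h, zero_mul] at this
    exact zero_ne_one this
  rw [aeval_aeval_theta, aeval_theta M w hwinv]
  exact (mem_vanishingIdeal_iff.1 hp) _ ⟨_, ⟨hwW, hwt⟩, rfl⟩

omit [CharZero E] [IsAlgClosed E] [IsAlgClosed F] [Algebra E F] in
/-- **`ker φ_E` is contained in the polynomials vanishing on `[M](W ∩ Gⁿ)`.** [folklore] -/
theorem ker_le_vanishingIdeal_image (M : Matrix (Fin n) (Fin n) ℤ) :
    RingHom.ker ((Ideal.Quotient.mkₐ E (graphIdeal (vanishingIdeal E W))).comp (aeval (theta (k := E) M))) ≤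
      vanishingIdeal E (matrixAct M '' (W ∩ torusLocus E n)) := by
  intro p hp
  rw [RingHom.mem_ker, AlgHom.comp_apply, Ideal.Quotient.mkₐ_eq_mk, Ideal.Quotient.eq_zero_iff_mem] at hp
  rw [mem_vanishingIdeal_iff]
  rintro _ ⟨z, ⟨hzW, hzt⟩, rfl⟩
  have h0 := aeval_eq_zero_of_mem_graphIdeal (vanishingIdeal E W) (T := E) z
    (fun q hq => (mem_vanishingIdeal_iff.1 hq) z hzW) hzt hp
  rw [aeval_aeval_theta, aeval_theta M _ (fun j => mul_inv_cancel₀ (hzt j))] at h0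
  exact h0

/-- **Rotundity ascends to the base change** (Zilber 2005 §3; needed for the base change of a
rotund variety over an `ecl`-closed subfield in Bays–Kirby 2018, proof of Thm 8.2).
[cite: Zilber2005, §3] [cite: BaysKirby2018ANT, Thm 8.2 (proof)] -/
theorem isRotund_baseChange (hirr : IsIrreducibleClosed E W) (hne : (W ∩ torusLocus E n).Nonempty)
    (hrot : IsRotund E n (W ∩ torusLocus E n)) : IsRotund F n (baseChange F W ∩ torusLocus F n) := by
  classical
  intro M
  haveI := hirr.2
  have hP := prodY_ne_zero hne
  set P := vanishingIdeal E W with hPdef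
  set P' := graphIdeal P with hP'def
  haveI hP'prime : P'.IsPrime := isPrime_graphIdeal _ hP
  set P'F := P'.map (MvPolynomial.map (algebraMap E F)) with hP'Fdef
  haveI : P'F.IsPrime := isPrime_map (F := F) _
  -- the `E`-side map and its range, an affine domain
  set φE : MvPolynomial (Fin n ⊕ Fin n) E →ₐ[E] (MvPolynomial (GIdx n) E ⧸ P') :=
    (Ideal.Quotient.mkₐ E P').comp (aeval (theta (k := E) M)) with hφE
  haveI : IsDomain (MvPolynomial (GIdx n) E ⧸ P') := Ideal.Quotient.isDomain P'
  set A : Subalgebra E (MvPolynomial (GIdx n) E ⧸ P') := φE.range with hA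
  haveI : Algebra.FiniteType E A :=
    Algebra.FiniteType.of_surjective φE.rangeRestrict (AlgHom.rangeRestrict_surjective φE)
  -- `rk M ≤ dim E[X]/ker φE = trdeg A`
  set r : ℕ := (M.map (Int.cast : ℤ → ℚ)).rank with hr
  have h1 : (r : WithBot ℕ∞) ≤ ringKrullDim A := by
    refine (hrot M).trans ?_
    unfold zariskiDim
    have hle := ker_le_vanishingIdeal_image (W := W) M
    refine (ringKrullDim_le_of_surjective (Ideal.Quotient.factor hle)
      (Ideal.Quotient.factor_surjective hle)).trans (le_of_eq ?_)
    have e : (MvPolynomial (Fin n ⊕ Fin n) E ⧸ RingHom.ker φE) ≃ₐ[E] A :=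
      (Ideal.quotientEquivAlgOfEq E (AlgHom.ker_rangeRestrict φE).symm).trans
        (Ideal.quotientKerAlgEquivOfSurjective (AlgHom.rangeRestrict_surjective φE))
    exact ringKrullDim_eq_of_ringEquiv e.toRingEquiv
  rw [Literature.RingTheory.KrullDimension.ringKrullDim_eq_trdeg E A] at h1
  have h2 : r ≤ Cardinal.toNat (Algebra.trdeg E A) := by exact_mod_cast h1
  -- a transcendence basis among the generators
  set gen : Fin n ⊕ Fin n → A := fun c => ⟨φE (X c), ⟨X c, rfl⟩⟩ with hgen
  have hadj : Algebra.adjoin E (Set.range gen) = ⊤ := by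
    apply Subalgebra.map_injective (f := A.val) Subtype.val_injective
    rw [AlgHom.map_adjoin, Algebra.map_top, ← Set.range_comp]
    change Algebra.adjoin E (Set.range fun c => φE (X c)) = A.val.range
    rw [show A.val.range = A from Subalgebra.range_val A, hA]
    conv_rhs => rw [MvPolynomial.aeval_unique φE]
    exact Algebra.adjoin_range_eq_range_aeval E (⇑φE ∘ X)
  haveI : FaithfulSMul E A := (faithfulSMul_iff_algebraMap_injective E A).2 (algebraMap E A).injective
  haveI : Algebra.IsAlgebraic (Algebra.adjoin E (Set.range gen)) A :=
    ⟨fun a => isAlgebraic_algebraMap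
      (⟨a, hadj.symm ▸ Algebra.mem_top⟩ : Algebra.adjoin E (Set.range gen))⟩
  obtain ⟨t, hts, ht⟩ := exists_isTranscendenceBasis_subset (R := E) (A := A) (Set.range gen)
  have htfin : t.Finite := (Set.finite_range gen).subset hts
  haveI : Fintype t := htfin.fintype
  have hcard : r ≤ Fintype.card t := by
    have h3 := ht.cardinalMk_eq_trdeg
    rw [Cardinal.mk_fintype] at h3
    rw [← h3, Cardinal.toNat_natCast] at h2
    exact h2
  obtain ⟨κ⟩ : Nonempty (Fin r ↪ t) := Function.Embedding.nonempty_of_card_le (by simpa using hcard)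
  have hind : AlgebraicIndependent E fun l => ((κ l : t) : A) := ht.1.comp κ κ.injective
  have hc : ∀ l, ∃ c, gen c = (κ l : A) := fun l => hts (κ l).2
  choose c hc using hc
  have hind' : AlgebraicIndependent E fun l => Ideal.Quotient.mk P' (theta (k := E) M (c l)) := by
    have h4 : AlgebraicIndependent E (A.val ∘ fun l => ((κ l : t) : A)) := hind.map' Subtype.val_injective
    convert h4 using 1
    funext l
    rw [Function.comp_apply, ← hc l]
    simp [gen, φE]
  -- transfer to `F`
  have hindF := Literature.FieldTheory.Regular.algebraicIndependent_map_mk (F' := F) P'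
    (fun l => theta (k := E) M (c l)) hind'
  set φF : MvPolynomial (Fin n ⊕ Fin n) F →ₐ[F] (MvPolynomial (GIdx n) F ⧸ P'F) :=
    (Ideal.Quotient.mkₐ F P'F).comp (aeval (theta (k := F) M)) with hφF
  haveI : IsDomain (MvPolynomial (GIdx n) F ⧸ P'F) := Ideal.Quotient.isDomain P'F
  have hg : AlgebraicIndependent F fun l => φF (X (c l)) := by
    convert hindF using 1
    funext l
    simp only [φF, AlgHom.comp_apply, aeval_X, Ideal.Quotient.mkₐ_eq_mk, map_theta]
    rfl
  have h5 := le_zariskiDim_of_algebraicIndependent (matrixAct M '' (baseChange F W ∩ torusLocus F n))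
    φF (vanishingIdeal_image_le_ker hirr hne M) (fun l => X (c l)) hg
  simpa using h5

end Ascent

end VarietyAscent

end Literature.NumberTheory.Transcendental

end
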